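import Literature.Computability.MetaComplexity.MCSPStarProofs
import Literature.Computability.Complexity.CircuitComposition
import Literature.Computability.Complexity.CircuitLightCone
import HarnessLib

/-! # SoloInformedPartialMCSP — light cones of `B₂`-circuits, cheap literal conjunctions, and the slice `MCSP*[s]`

Solo informed, generation 10.  Infrastructure for `SoloInformedPartialStreaming` (a one-pass SPACE
lower bound, linear in the input length, for the PARTIAL-function Minimum Circuit Size Problem at
the read-once threshold — in contrast with total `MCSP`, which the exhaustive-search decider of
`SoloInformedStreamingCeiling` handles in polylogarithmic space at the same threshold):

* `card_lightCone_le_size_succ`: a circuit over the full binary basis `B₂` with `g` gates has a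
  backward light cone of at most `g + 1` input variables (induction on the gate list: a new gate of
  fan-in `≤ 2` reads at most two wires, each an input variable or an earlier light cone); hence a
  `B₂`-circuit with at most `n - 2` gates on `n` variables ignores some variable
  (`exists_forall_update_eq`).
* `cktSize_conjL` / `exists_circuit_conjL`: a conjunction of `m ≥ 2` literals costs `m - 1` gates.
* `mcspStarSize s`: the `s`-slice of the tree's `MCSPStar` (codes of partial truth tables
  `Fin (2ⁿ) → Option Bool` admitting a consistent `B₂`-circuit with at most `s n` gates), with its
  membership lemma, its agreement with `MCSPStar` (`encode_mem_mcspStarSize_iff_MCSPStar`) and with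
  `MCSPSize s` on total tables (`encode_map_some_mem_mcspStarSize_iff`).

Landed as new mathematics under the host summit per the tree convention; no Literature fact is
introduced. -/

noncomputable section
namespace Summit.PneNP.PneNP.Theorems
open Finset Computability Literature.Computability.Complexity Literature.Computability.MetaComplexity

namespace SoloPartial

variable {ι : Type*} [DecidableEq ι]

/-- The input variable read by a wire (`∅` for a gate wire). -/
def leafOf : ι ⊕ ℕ → Finset ι
  | .inl i => {i}
  | .inr _ => ∅

/-- The earlier gate (index `< L`) read by a wire (`∅` for an input wire or a dangling index). -/
def idxOf (L : ℕ) : ι ⊕ ℕ → Finset ℕ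
  | .inl _ => ∅
  | .inr m => if m < L then {m} else ∅

omit [DecidableEq ι] in
/-- A wire reads at most one thing: an input variable or an earlier gate. -/
theorem card_idxOf_add_card_leafOf (L : ℕ) (w : ι ⊕ ℕ) :
    (idxOf L w).card + (leafOf w : Finset ι).card ≤ 1 := by
  cases w with
  | inl i => simp [leafOf, idxOf]
  | inr m => by_cases h : m < L <;> simp [leafOf, idxOf, h]

/-- The dependency set (backward light cone) of gate `j` of the program `gs` (`∅` out of range). -/
abbrev D (gs : List (Gate ι)) (j : ℕ) : Finset ι := (GateList.deps gs).getD j ∅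

/-- Out of range the light cone is empty. -/
theorem D_of_le {gs : List (Gate ι)} {j : ℕ} (hj : gs.length ≤ j) : D gs j = ∅ :=
  List.getD_eq_default _ _ (by simpa using hj)

/-- The light cone of a newly appended gate. -/
theorem D_append_length (gs : List (Gate ι)) (g : Gate ι) :
    D (gs ++ [g]) gs.length = GateList.depOf (GateList.deps gs) g := by
  simp only [D, GateList.deps_append_singleton]
  rw [List.getD_append_right _ _ _ _ (by simp)]
  simp

/-- Appending a gate does not change the earlier light cones. -/
theorem D_append_of_ne (gs : List (Gate ι)) (g : Gate ι) {j : ℕ} (hj : j ≠ gs.length) :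
    D (gs ++ [g]) j = D gs j := by
  rcases lt_or_gt_of_ne hj with h | h
  · simp only [D, GateList.deps_append_singleton]
    rw [List.getD_append _ _ _ _ (by simpa using h)]
  · rw [D_of_le (by simp; omega), D_of_le (by omega)]

/-- The new gate's light cone is covered by its input wires and the light cones of the earlier
gates it reads. -/
theorem depOf_subset (gs : List (Gate ι)) (g : Gate ι) :
    GateList.depOf (GateList.deps gs) g ⊆
      (univ.biUnion fun a => idxOf gs.length (g.args a)).biUnion (D gs) ∪
        univ.biUnion fun a => leafOf (g.args a) := by
  intro i hi
  simp only [GateList.depOf, mem_biUnion, mem_univ, true_and] at hi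
  obtain ⟨a, ha⟩ := hi
  rw [mem_union, mem_biUnion, mem_biUnion]
  cases hw : g.args a with
  | inl i' =>
    rw [hw] at ha
    exact Or.inr ⟨a, mem_univ _, by rw [hw]; simpa [leafOf] using ha⟩
  | inr m =>
    rw [hw] at ha
    change i ∈ D gs m at ha
    refine Or.inl ⟨m, ?_, ha⟩
    rw [mem_biUnion]
    refine ⟨a, mem_univ _, ?_⟩
    rw [hw]
    have hm : m < gs.length := by
      by_contra hm
      rw [D_of_le (by omega)] at ha
      simp at ha
    simp [idxOf, hm]

/-- **Few gates read few variables.** Over fan-in `≤ 2`, the union of the light cones of any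
set `R` of gates of a program with `L` gates has at most `L + |R|` input variables. -/
theorem card_biUnion_D_le (gs : List (Gate ι)) (h2 : ∀ g ∈ gs, g.arity ≤ 2) :
    ∀ R : Finset ℕ, (R.biUnion (D gs)).card ≤ gs.length + R.card := by
  induction gs using List.reverseRecOn with
  | nil =>
    intro R
    have : R.biUnion (D ([] : List (Gate ι))) = ∅ :=
      eq_empty_of_forall_notMem fun i hi => by
        obtain ⟨j, -, hj⟩ := mem_biUnion.1 hi
        rw [D_of_le (by simp)] at hj
        simp at hj
    simp [this]
  | append_singleton gs g ih =>
    intro R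
    have h2' : ∀ g' ∈ gs, g'.arity ≤ 2 := fun g' hg' => h2 g' (by simp [hg'])
    have hg : g.arity ≤ 2 := h2 g (by simp)
    by_cases hL : gs.length ∈ R
    · set Ix : Finset ℕ := univ.biUnion fun a => idxOf gs.length (g.args a) with hIx
      set Lv : Finset ι := univ.biUnion fun a => leafOf (g.args a) with hLv
      set R' : Finset ℕ := R.erase gs.length ∪ Ix with hR'
      have hLR' : gs.length ∉ R' := by
        intro h
        rcases mem_union.1 h with h | h
        · exact (notMem_erase _ _) h
        · rw [hIx, mem_biUnion] at h
          obtain ⟨a, -, ha⟩ := h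
          cases hw : g.args a with
          | inl i => rw [hw] at ha; simp [idxOf] at ha
          | inr m =>
            rw [hw] at ha
            by_cases hm : m < gs.length <;> simp [idxOf, hm] at ha
            omega
      have hsub : R.biUnion (D (gs ++ [g])) ⊆ R'.biUnion (D gs) ∪ Lv := by
        intro i hi
        obtain ⟨j, hj, hij⟩ := mem_biUnion.1 hi
        by_cases hjL : j = gs.length
        · subst hjL
          rw [D_append_length] at hij
          rcases mem_union.1 (depOf_subset gs g hij) with h | h
          · obtain ⟨m, hm, him⟩ := mem_biUnion.1 h
            exact mem_union_left _ (mem_biUnion.2 ⟨m, mem_union_right _ hm, him⟩)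
          · exact mem_union_right _ h
        · rw [D_append_of_ne gs g hjL] at hij
          exact mem_union_left _
            (mem_biUnion.2 ⟨j, mem_union_left _ (mem_erase.2 ⟨hjL, hj⟩), hij⟩)
      have heq : R'.biUnion (D gs) = R'.biUnion (D gs) := rfl
      have hIL : Ix.card + Lv.card ≤ 2 :=
        calc Ix.card + Lv.card
            ≤ ∑ a, (idxOf gs.length (g.args a)).card + ∑ a, (leafOf (g.args a) : Finset ι).card :=
              add_le_add card_biUnion_le card_biUnion_le
          _ = ∑ a, ((idxOf gs.length (g.args a)).card + (leafOf (g.args a) : Finset ι).card) :=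
              sum_add_distrib.symm
          _ ≤ ∑ _a : Fin g.arity, 1 := sum_le_sum fun a _ => card_idxOf_add_card_leafOf _ _
          _ ≤ 2 := by simpa using hg
      have hR'c : R'.card ≤ R.card - 1 + Ix.card :=
        (card_union_le _ _).trans (by rw [card_erase_of_mem hL])
      have hRpos : 0 < R.card := card_pos.2 ⟨_, hL⟩
      calc (R.biUnion (D (gs ++ [g]))).card
          ≤ (R'.biUnion (D gs) ∪ Lv).card := card_le_card hsub
        _ ≤ (R'.biUnion (D gs)).card + Lv.card := card_union_le _ _
        _ ≤ gs.length + R'.card + Lv.card := by have := ih h2' R'; omega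
        _ ≤ (gs ++ [g]).length + R.card := by
            simp only [List.length_append, List.length_singleton]; omega
    · have heq : R.biUnion (D (gs ++ [g])) = R.biUnion (D gs) :=
        biUnion_congr rfl fun j hj => D_append_of_ne gs g fun h => hL (h ▸ hj)
      rw [heq]
      exact (ih h2' R).trans (by simp)

/-- One light cone: at most `L + 1` input variables. -/
theorem card_D_le (gs : List (Gate ι)) (h2 : ∀ g ∈ gs, g.arity ≤ 2) (j : ℕ) :
    (D gs j).card ≤ gs.length + 1 := by
  simpa using card_biUnion_D_le gs h2 {j}

/-- **A circuit with `s` gates of fan-in `≤ 2` has at most `s + 1` input variables in its light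
cone** (so a function depending on all of `m` variables needs `m - 1` binary gates). -/
theorem card_lightCone_le_size_succ (C : Circuit ι) (hC : C.IsOver B2) :
    C.lightCone.card ≤ C.size + 1 := by
  unfold Circuit.lightCone
  split
  · simp
  · exact card_D_le C.gates (fun g hg => hC g hg) _

/-- Hence a circuit over `B₂` with at most `n - 2` gates on `n` variables ignores some variable. -/
theorem exists_forall_update_eq {n : ℕ} (C : Circuit (Fin n)) (hC : C.IsOver B2)
    (hs : C.size + 2 ≤ n) : ∃ j : Fin n, ∀ x b, C.eval (Function.update x j b) = C.eval x := by
  have hlt : C.lightCone.card < (univ : Finset (Fin n)).card := by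
    rw [card_univ, Fintype.card_fin]
    have := card_lightCone_le_size_succ C hC
    omega
  obtain ⟨j, -, hj⟩ := exists_mem_notMem_of_card_lt_card hlt
  exact ⟨j, fun x b => C.eval_congr_lightCone fun i hi =>
    Function.update_of_ne (by rintro rfl; exact hj hi) _ _⟩

end SoloPartial

namespace SoloPartial

/-! ### Literal conjunctions are cheap over `B₂` -/

section Conj
variable {ι : Type*}

/-- The conjunction of the literals `x i = c` over `(i, c) ∈ l`. -/
def conjL : List (ι × Bool) → (ι → Bool) → Bool
  | [], _ => true
  | p :: l, x => (x p.1 == p.2) && conjL l x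

/-- Semantics of `conjL`. -/
theorem conjL_eq_true_iff : ∀ (l : List (ι × Bool)) (x : ι → Bool),
    conjL l x = true ↔ ∀ p ∈ l, x p.1 = p.2
  | [], x => by simp [conjL]
  | p :: l, x => by simp [conjL, conjL_eq_true_iff l x]

/-- A conjunction of `m + 2` literals costs `m + 1` binary gates over `B₂`. -/
theorem cktSize_conjL : ∀ (p q : ι × Bool) (l : List (ι × Bool)),
    CktSize B2 (fun (x : ι → Bool) (_ : Unit) => conjL (p :: q :: l) x) (l.length + 1)
  | p, q, [] =>
    (CktSize.gate (B := B2) (ι := ι) ⟨2, fun v => (v 0 == p.2) && (v 1 == q.2)⟩ (by simp [B2])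
      ![p.1, q.1]).congr fun x _ => by simp [conjL]
  | p, q, r :: l => by
    have h1 : CktSize B2 (fun (x : ι → Bool) =>
        Sum.elim x (fun _ : Unit => conjL (q :: r :: l) x)) (0 + (l.length + 1)) :=
      (CktSize.id B2).pair (cktSize_conjL q r l)
    have h2 : CktSize B2 (fun (y : ι ⊕ Unit → Bool) (_ : Unit) =>
        (y (.inl p.1) == p.2) && y (.inr ())) 1 :=
      (CktSize.gate (B := B2) (ι := ι ⊕ Unit) ⟨2, fun v => (v 0 == p.2) && v 1⟩ (by simp [B2])
        ![Sum.inl p.1, Sum.inr ()]).congr fun y _ => by simp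
    exact ((h1.comp h2).of_le (by simp)).congr fun x _ => by simp [conjL]

/-- Hence a conjunction of `|l| ≥ 2` literals is computed by a `B₂`-circuit with `|l| - 1` gates. -/
theorem exists_circuit_conjL (l : List (ι × Bool)) (hl : 2 ≤ l.length) :
    ∃ C : Circuit ι, C.IsOver B2 ∧ C.size + 1 ≤ l.length ∧ ∀ x, C.eval x = conjL l x := by
  match l, hl with
  | p :: q :: l, _ =>
    obtain ⟨C, hB, hs, hC⟩ := (cktSize_conjL p q l).toCircuit
    exact ⟨C, hB, by simp only [List.length_cons]; omega, fun x => hC x⟩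

end Conj

/-! ### The slice `MCSP*[s]` of the partial-function Minimum Circuit Size Problem -/

/-- `MCSP*[s]`: codes of partial truth tables `T : Fin (2ⁿ) → Option Bool` (arity `n` read off the
list length `2ⁿ`, entries listed in the order `boolFunEquivFin n`, `none` = "don't care") such that
some circuit over `B₂` on `n` inputs with at most `s n` gates agrees with every defined entry —
the `s`-slice of the tree's `MCSPStar` exactly as `MCSPSize s` is the `s`-slice of `MCSP`. -/
def mcspStarSize (s : ℕ → ℕ) : Language Bool :=
  {w | ∃ (n : ℕ) (T : Fin (2 ^ n) → Option Bool),
    w = (encodingBoolBool.optionBool).listBool.encode (List.ofFn T) ∧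
    ∃ C : Circuit (Fin n), C.IsOver B2 ∧ C.size ≤ s n ∧
      ∀ (i : Fin (2 ^ n)) (b : Bool), T i = some b → C.eval ((boolFunEquivFin n).symm i) = b}

/-- Membership of a well-formed partial table in `MCSP*[s]` (the code determines `n` and `T`). -/
theorem encode_mem_mcspStarSize_iff (s : ℕ → ℕ) {n : ℕ} (T : Fin (2 ^ n) → Option Bool) :
    (encodingBoolBool.optionBool).listBool.encode (List.ofFn T) ∈ mcspStarSize s ↔
      ∃ C : Circuit (Fin n), C.IsOver B2 ∧ C.size ≤ s n ∧
        ∀ (i : Fin (2 ^ n)) (b : Bool), T i = some b → C.eval ((boolFunEquivFin n).symm i) = b := by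
  constructor
  · rintro ⟨m, T', hw, hC⟩
    have hl := (encodingBoolBool.optionBool).listBool.encode_injective hw
    have hlen := congrArg List.length hl
    simp only [List.length_ofFn] at hlen
    obtain rfl : n = m := Nat.pow_right_injective le_rfl hlen
    obtain rfl : T = T' := List.ofFn_injective hl
    exact hC
  · exact fun hC => ⟨n, T, rfl, hC⟩

/-- `MCSP*[s]` is the `s`-slice of `MCSP*`: `enc T ∈ MCSP*[s] ↔ ⟨enc T, bin (s n)⟩ ∈ MCSP*`. -/
theorem encode_mem_mcspStarSize_iff_MCSPStar (s : ℕ → ℕ) {n : ℕ} (T : Fin (2 ^ n) → Option Bool) :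
    (encodingBoolBool.optionBool).listBool.encode (List.ofFn T) ∈ mcspStarSize s ↔
      boolPair ((encodingBoolBool.optionBool).listBool.encode (List.ofFn T)) (encodeNat (s n)) ∈
        MCSPStar := by
  rw [encode_mem_mcspStarSize_iff, boolPair_encode_mem_MCSPStar_iff]

/-- `MCSP*[s]` extends `MCSP[s]`: on `⋆`-free tables the two slices agree. -/
theorem encode_map_some_mem_mcspStarSize_iff (s : ℕ → ℕ) {n : ℕ} (f : (Fin n → Bool) → Bool) :
    (encodingBoolBool.optionBool).listBool.encode ((truthTable f).map some) ∈ mcspStarSize s ↔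
      truthTable f ∈ MCSPSize s := by
  rw [truthTable_mem_MCSPSize_iff, truthTable, List.map_ofFn, encode_mem_mcspStarSize_iff_MCSPStar]
  exact boolPair_encode_some_mem_MCSPStar_iff_holds f (s n)

end SoloPartial

end Summit.PneNP.PneNP.Theorems
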